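import Literature.NumberTheory.Transcendental.RoySmallValueDerivationAlgebra
import HarnessLib

/-!
# Roy's small value estimate for `𝔾ₐ × 𝔾ₘ` — §5 Lemma 5.4 (common factors of `P, 𝒟P, …, 𝒟ᵏP`)

Topic `Literature/NumberTheory/Transcendental`. Part of the formalisation of the proof of Roy 2013,
Theorem 1.1 (named fact `roy2013_thm_1_1`, `RoySmallValueEstimates.lean`). Source: D. Roy,
*A small value estimate for `𝔾ₐ × 𝔾ₘ`*, Mathematika 59 (2013) 333–363 = arXiv:1301.0663, §5,
Lemma 5.4 (p. 14 of the arXiv text):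

> **Lemma 5.4.** Let `D` be a positive integer and let `P ∈ ℚ[X]_D` with `X₀ ∤ P` and
> `X₂ ∤ P`. If an irreducible homogeneous polynomial `R ∈ ℚ[X]` divides `P, 𝒟P, …, 𝒟ᵏP` for
> some integer `k ≥ 0`, then `R^{k+1}` divides `P`. In particular, the polynomials
> `P, 𝒟P, …, 𝒟^D P` have no common irreducible factor in `ℚ[X]`.

Proved over any field `K` of characteristic `0` (`lemma_5_4`, `lemma_5_4_no_common_factor`),
following the printed proof: write `P = Rᵉ Q` with `R ∤ Q`; then
`𝒟ⁱP ≡ e(e-1)⋯(e-i+1) R^{e-i} (𝒟R)ⁱ Q (mod R^{e-i+1})` (`iterate_homDK_pow_mul`), so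
`𝒟ᵉP ≡ e! (𝒟R)ᵉ Q (mod R)` is not divisible by `R` because `R ∤ 𝒟R` (Lemma 5.3: `R` is not
associated to `X₀` or `X₂` as these do not divide `P`).

Also: divisors of non-zero forms are forms (`isHomogeneous_of_dvd`, comparing bottom
components in the domain `K[X]`), needed to apply Lemma 5.3 to irreducible factors of `P`.

Everything here is proved; no definitions, no new named facts.

## References

* [Roy2013] D. Roy, *A small value estimate for 𝔾ₐ × 𝔾ₘ*, Mathematika 59 (2013), 333–363
  (arXiv:1301.0663), §5, Lemma 5.4.
-/

noncomputable section

open MvPolynomial Finset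

namespace Literature.NumberTheory.Transcendental

namespace Roy2013

/-! ### Divisors of forms are forms -/

section Forms

variable {σ : Type*} {K : Type*} [CommRing K] [IsDomain K]

omit [IsDomain K] in
/-- The least degree of a monomial of `f ≠ 0`. [folklore] -/
theorem exists_min_degree {f : MvPolynomial σ K} (hf : f ≠ 0) :
    ∃ m : ℕ, (∃ d ∈ f.support, d.degree = m) ∧ ∀ d ∈ f.support, m ≤ d.degree := by
  obtain ⟨d, hd, hmin⟩ := f.support.exists_min_image Finsupp.degree (support_nonempty.mpr hf)
  exact ⟨d.degree, ⟨d, hd, rfl⟩, hmin⟩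

omit [IsDomain K] in
/-- **Bottom components multiply**: if `m_f`, `m_g` are the least degrees of monomials of `f`,
`g`, then in degree `m_f + m_g` the product `fg` has the coefficients of
`f_{m_f} g_{m_g}`. [folklore] -/
theorem coeff_mul_eq_coeff_component_mul [DecidableEq σ] {f g : MvPolynomial σ K} {mf mg : ℕ}
    (hf : ∀ d ∈ f.support, mf ≤ d.degree) (hg : ∀ d ∈ g.support, mg ≤ d.degree)
    {e : σ →₀ ℕ} (he : e.degree = mf + mg) :
    coeff e (f * g) = coeff e (homogeneousComponent mf f * homogeneousComponent mg g) := by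
  rw [coeff_mul, coeff_mul]
  refine Finset.sum_congr rfl fun x hx => ?_
  rw [mem_antidiagonal] at hx
  have hdeg : x.1.degree + x.2.degree = mf + mg := by rw [← map_add, hx, he]
  rw [coeff_homogeneousComponent, coeff_homogeneousComponent]
  by_cases h1 : x.1.degree = mf
  · have h2 : x.2.degree = mg := by omega
    rw [if_pos h1, if_pos h2]
  · rw [if_neg h1, zero_mul]
    rcases Nat.lt_or_gt_of_ne h1 with hlt | hgt
    · rw [notMem_support_iff.mp (fun h => absurd (hf _ h) (not_le.mpr hlt)), zero_mul]
    · have h2 : x.2.degree < mg := by omega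
      rw [notMem_support_iff.mp (fun h => absurd (hg _ h) (not_le.mpr h2)), mul_zero]

/-- **Divisors of non-zero forms are forms** (in `K[X]`, `K` a domain): if `R A = P` with `P`
homogeneous and non-zero then `R` is homogeneous (of degree its total degree).
[folklore] -/
theorem isHomogeneous_of_dvd {R P : MvPolynomial σ K} {n : ℕ} (hP : P.IsHomogeneous n)
    (hP0 : P ≠ 0) (hRP : R ∣ P) : R.IsHomogeneous R.totalDegree := by
  classical
  obtain ⟨A, rfl⟩ := hRP
  have hR0 : R ≠ 0 := left_ne_zero_of_mul hP0
  have hA0 : A ≠ 0 := right_ne_zero_of_mul hP0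
  obtain ⟨mR, ⟨dR, hdR, hdRm⟩, hRmin⟩ := exists_min_degree hR0
  obtain ⟨mA, ⟨dA, hdA, hdAm⟩, hAmin⟩ := exists_min_degree hA0
  -- the bottom components are non-zero forms
  have hbR : (homogeneousComponent mR R).IsHomogeneous mR := homogeneousComponent_isHomogeneous _ _
  have hbA : (homogeneousComponent mA A).IsHomogeneous mA := homogeneousComponent_isHomogeneous _ _
  have hbR0 : homogeneousComponent mR R ≠ 0 := by
    intro h
    have := congr_arg (coeff dR) h
    rw [coeff_homogeneousComponent, if_pos hdRm, coeff_zero] at this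
    exact (mem_support_iff.mp hdR) this
  have hbA0 : homogeneousComponent mA A ≠ 0 := by
    intro h
    have := congr_arg (coeff dA) h
    rw [coeff_homogeneousComponent, if_pos hdAm, coeff_zero] at this
    exact (mem_support_iff.mp hdA) this
  have hprod0 : homogeneousComponent mR R * homogeneousComponent mA A ≠ 0 := mul_ne_zero hbR0 hbA0
  -- so `R A` has a non-zero coefficient in degree `mR + mA`, forcing `mR + mA = n`
  obtain ⟨e, he⟩ := exists_coeff_ne_zero hprod0
  have hedeg : e.degree = mR + mA := by
    rw [Finsupp.degree_eq_weight_one]; exact (hbR.mul hbA) he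
  have hcoeff : coeff e (R * A) ≠ 0 := by
    rwa [coeff_mul_eq_coeff_component_mul hRmin hAmin hedeg]
  have hn : mR + mA = n := by
    have h : e.degree = n := by rw [Finsupp.degree_eq_weight_one]; exact hP hcoeff
    omega
  -- total degrees: `tR + tA = n`, `mR ≤ tR`, `mA ≤ tA`
  have ht := totalDegree_mul_of_isDomain hR0 hA0
  rw [hP.totalDegree hP0] at ht
  have hmR : mR ≤ R.totalDegree := hdRm ▸ le_totalDegree hdR
  have hmA : mA ≤ A.totalDegree := hdAm ▸ le_totalDegree hdA
  have heq : mR = R.totalDegree := by omega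
  -- all monomials of `R` have degree `tR`
  intro d hd
  have hd' : d ∈ R.support := mem_support_iff.mpr hd
  have h1 := hRmin d hd'
  have h2 := le_totalDegree hd'
  change d.degree ≤ R.totalDegree at h2
  have h3 : d.degree = R.totalDegree := by omega
  rw [Finsupp.degree_eq_weight_one] at h3
  exact h3

end Forms

/-! ### Iterated derivatives of `Rᵉ Q` -/

section Field

variable {K : Type*} [Field K] [CharZero K]

omit [CharZero K] in
/-- **`𝒟ⁱ(Rᵉ Q) ≡ e(e-1)⋯(e-i+1) R^{e-i} (𝒟R)ⁱ Q (mod R^{e-i+1})`** for `i ≤ e`.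
[cite: Roy2013, §5, proof of Lemma 5.4] -/
theorem iterate_homDK_pow_mul (R Q : MvPolynomial (Fin 3) K) (e : ℕ) :
    ∀ i ≤ e, ∃ B : MvPolynomial (Fin 3) K,
      (homDK K)^[i] (R ^ e * Q) =
        (e.descFactorial i : ℕ) • (R ^ (e - i) * homDK K R ^ i * Q) + R ^ (e - i + 1) * B := by
  intro i
  induction i with
  | zero =>
    intro _
    exact ⟨0, by simp⟩
  | succ i ih =>
    intro hi
    obtain ⟨B, hB⟩ := ih (by omega)
    obtain ⟨j, hj⟩ : ∃ j, e - i = j + 1 := ⟨e - i - 1, by omega⟩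
    have hj' : e - (i + 1) = j := by omega
    rw [hj] at hB
    refine ⟨(e.descFactorial i : ℕ) • (((i : ℕ) • (homDK K R ^ (i - 1) *
        homDK K (homDK K R))) * Q + homDK K R ^ i * homDK K Q) +
        ((j + 1 + 1 : ℕ) • (homDK K R * B) + R * homDK K B), ?_⟩
    rw [Function.iterate_succ_apply', hB, hj', Nat.descFactorial_succ, hj, map_add, map_nsmul]
    simp only [Derivation.leibniz, Derivation.leibniz_pow, Nat.add_sub_cancel,
      smul_eq_mul, nsmul_eq_mul, Nat.cast_mul, Nat.cast_add, Nat.cast_one]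
    ring

/-- **Roy 2013, Lemma 5.4**: let `P ∈ K[X]` be a non-zero form with `X₀ ∤ P` and `X₂ ∤ P`
(`K` a field of characteristic `0`). If an irreducible `R` divides `P, 𝒟P, …, 𝒟ᵏP`, then
`R^{k+1} ∣ P`. (`R` is automatically homogeneous, `isHomogeneous_of_dvd`.) [cite: Roy2013, Lemma 5.4] -/
theorem lemma_5_4 {P : MvPolynomial (Fin 3) K} {D : ℕ} (hP : P.IsHomogeneous D) (hP0 : P ≠ 0)
    (hX0 : ¬ X 0 ∣ P) (hX2 : ¬ X 2 ∣ P) {R : MvPolynomial (Fin 3) K} (hirr : Irreducible R)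
    {k : ℕ} (hdvd : ∀ i ≤ k, R ∣ (homDK K)^[i] P) : R ^ (k + 1) ∣ P := by
  -- `R` is homogeneous and not associated to `X₀`, `X₂`, hence `R ∤ 𝒟R`
  have hRP : R ∣ P := by simpa using hdvd 0 (Nat.zero_le _)
  have hRh := isHomogeneous_of_dvd hP hP0 hRP
  have hRD : ¬ R ∣ homDK K R := by
    intro h
    rcases lemma_5_3 hRh hirr h with h0 | h2
    · exact hX0 (h0.symm.dvd.trans hRP)
    · exact hX2 (h2.symm.dvd.trans hRP)
  -- `P = Rᵉ Q`, `R ∤ Q`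
  obtain ⟨e, Q, hRQ, hPe⟩ := WfDvdMonoid.max_power_factor hP0 hirr
  -- `e ≥ k + 1`, for otherwise `R ∣ 𝒟ᵉ P ≡ e! (𝒟R)ᵉ Q (mod R)`
  suffices hk : k + 1 ≤ e by
    rw [hPe]; exact (pow_dvd_pow R hk).mul_right Q
  by_contra hlt
  push Not at hlt
  have hle : e ≤ k := by omega
  obtain ⟨B, hB⟩ := iterate_homDK_pow_mul R Q e e le_rfl
  rw [Nat.sub_self, pow_zero, one_mul, zero_add, pow_one, Nat.descFactorial_self] at hB
  have h1 : R ∣ (e.factorial : ℕ) • (homDK K R ^ e * Q) := by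
    have h := hdvd e hle
    rw [hPe, hB] at h
    exact (dvd_add_left (dvd_mul_right R B)).mp h
  rw [nsmul_eq_mul] at h1
  have hprime : Prime R := hirr.prime
  rcases hprime.dvd_or_dvd h1 with h2 | h2
  · -- `R ∣ e!`: impossible, `e!` is a unit
    have hu : IsUnit ((e.factorial : ℕ) : MvPolynomial (Fin 3) K) := by
      rw [← map_natCast C]
      exact (isUnit_iff_ne_zero.mpr (Nat.cast_ne_zero.mpr e.factorial_ne_zero)).map C
    exact hirr.not_isUnit (isUnit_of_dvd_unit h2 hu)
  · rcases hprime.dvd_or_dvd h2 with h3 | h3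
    · exact hRD (hprime.dvd_of_dvd_pow h3)
    · exact hRQ h3

/-- **Roy 2013, Lemma 5.4, "in particular"**: for a non-zero form `P ∈ K[X]_D` with `X₀ ∤ P`,
`X₂ ∤ P`, the polynomials `P, 𝒟P, …, 𝒟^D P` have no common irreducible factor.
[cite: Roy2013, Lemma 5.4] -/
theorem lemma_5_4_no_common_factor {P : MvPolynomial (Fin 3) K} {D : ℕ} (hP : P.IsHomogeneous D)
    (hP0 : P ≠ 0) (hX0 : ¬ X 0 ∣ P) (hX2 : ¬ X 2 ∣ P) {R : MvPolynomial (Fin 3) K}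
    (hirr : Irreducible R) (hdvd : ∀ i ≤ D, R ∣ (homDK K)^[i] P) : False := by
  have h := lemma_5_4 hP hP0 hX0 hX2 hirr hdvd
  -- degrees: `(D+1) deg R ≤ D` with `deg R ≥ 1`
  have hRP : R ∣ P := by simpa using hdvd 0 (Nat.zero_le _)
  have hRh := isHomogeneous_of_dvd hP hP0 hRP
  have hR1 : 1 ≤ R.totalDegree := by
    by_contra h0
    push Not at h0
    have : R.totalDegree = 0 := by omega
    rw [totalDegree_eq_zero_iff_eq_C] at this
    have hc : coeff 0 R ≠ 0 := by
      intro hc; exact hirr.ne_zero (by rw [this, hc, C_0])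
    exact hirr.not_isUnit (this ▸ (isUnit_iff_ne_zero.mpr hc).map C)
  have hdeg := totalDegree_le_of_dvd_of_isDomain h hP0
  rw [hP.totalDegree hP0, ((hRh.pow (D + 1))).totalDegree (pow_ne_zero _ hirr.ne_zero)] at hdeg
  nlinarith

end Field

end Roy2013

end Literature.NumberTheory.Transcendental
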